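import Summits.QuantumFields.BalabanUV.Beta.SymCorrectorFaceGauge
import Summits.QuantumFields.BalabanUV.Beta.D1BFx.ColumnGaugeCombPartner

/-!
# `BalabanUV.Beta.D1BFx.ColumnGaugeCombMergedFirstOrder` — road «BF-x», binder row D1, PART 24 HEAD (H1-lit) (`PART24-HEAD-SPEC-g24.md` «TWO PINS» §1):
# THE FULLY DRESSED FIRST-ORDER VERTEX OF THE COMB LITERAL — chart-transported AND bm-dressed — IS THE STRAIGHT ONE PLUS `[Λc + Λf, bhK + Dsh]`
# (the comb twin of gen 23's `ColumnGaugeMergedFirstOrder` for the native spine: leaf-03 g30 TT10 ∘ this lineage's `ColumnGaugeCombPartner` §3, composed BY NAME)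

HONEST DEPENDENCY (cell records, verbatim): «continuum YM on T⁴ ⇐ BetaPertH ∧ nine spine estimates (0/9 proved); BetaPertH ⇐ (D1) ∧ (D4) ∧
CAP+tail; G-an2-4 gates asym, D1 and NE2/3/4.»  HONEST FRAMING (cell contract, verbatim): «discharging `BetaPertH` makes Bałaban's UV stability
UNCONDITIONAL — a real constructive-QFT result; it is NOT the continuum limit and NOT the Clay problem.»  THIS MODULE DISCHARGES NO binder of
row D1 and NO estimate of Bałaban's: one [our object] identity between OUR kernels, composed from leaf-03 g30's `SymCorrectorFaceGauge.vertexOfK_conj_psiKS_eq_add_faceGauge`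
(TT10, p355478 ✓) under the comb literal's pointwise letter `ColumnGaugeCombPartner.divV_S_zero_eq_smul_conjV_leggedBorder` (partner `(n⁴∕2)•(bhK n + Dsh n)`, F-g24-1)
and `ColumnGaugeCombPartner.vertexOfK_G0bm_S_zero_eq_add_comm`.  No `def`, no `def … : Prop`, nothing cited, 0 sorry.  NOT D1, NOT BetaPertH, NOT continuum, NOT Clay.

ABSOLUTE RULE (cell charter, verbatim): «No internally-minted statement may enter as a cited fact. Every hypothesis is either kernel-proved in this
package or a verbatim quotation of a PUBLISHED theorem with page reference.»

THE IDENTITY.  Literal of record `S⁰ := (JsB12CombSh0 hodd N (symTablesAn1S2 3 n cΛ) cΛ cB 0).S` (`n` odd), road kernel `G₀ := coDressKBmAt ρ_c n (KInvStep n 0)`,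
`ρ_c = ctr 4 n`, corrector root offset `r′ ∈ box 4 n` (for the literal `r′ = ctrOff 4 n`, `SymCorrectorTransport.GcombSh_zero_eq_conj_psiKS_KInvStep`), `𝕄 := bhK n + Dsh n`:
`vertexOfK (Ψ̂_{r′}∘G₀∘Ψ̂_{r′}ᵀ) n S⁰ μ y = vertexOfK (KInvStep n 0) n S⁰ μ y + (Λc μ y∘𝕄 − 𝕄∘Λc μ y) + (Λf μ y∘𝕄 − 𝕄∘Λf μ y)`,
`Λc μ y = diagK (z b ↦ (n⁴∕2)·χ_{μ,y} (legSite ρ_c z b))`, `χ_{μ,y} = bmGaugeAt ρ_c (colH (KInvStep n 0) n μ y) n`,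
`Λf μ y = diagK (z b ↦ −Σ_α Σ_{x ∈ blockSitesF n (blk n (legSite ρ_c z b))} colH G₀ n μ y α x·((n⁴∕2)·faceWt r′ n α x))` — the `V + [Λ, M + D]` input of
`ColumnGaugeTwoPins` §2 (literal pin, `M + D = bhK + Dsh`: everything cancels) with ONE generator `Λ = Λc + Λf`.
Unit `b2b-balaban-beta-d1-p2` gen 24; no existing file touched.
-/

namespace Summit.QuantumFields.BalabanUV.Beta.D1BFx.ColumnGaugeCombMergedFirstOrder

open Literature.MathematicalPhysics.QuantumFieldTheory
open Literature.MathematicalPhysics.QuantumFieldTheory.Balaban1983to89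
open Literature.MathematicalPhysics.QuantumFieldTheory.Balaban1983to89.Beta
open ExpKernelCalculus (MKer comp)
open AffineAveraging (Site box toSite)
open AveragingContours (blk)
open AveragingContoursRooted (ctr ctrOff ctrOff_mem_box)
open OneStepResolventKernel (Fib LocStencil)
open OneStepKernelFamily (colH vertexOfK KInvStep)
open Summit.QuantumFields.BalabanUV.Beta.TameKernelCalculus (Spr trK)
open Summit.QuantumFields.BalabanUV.Beta.AxialDressingRooted (coDressKBmAt spr_coDressKBmAt)
open Summit.QuantumFields.BalabanUV.Beta.AxialProjectorBlockMean (bmGaugeAt)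
open Summit.QuantumFields.BalabanUV.Beta.BorderedHessian (diagK bhK)
open Summit.QuantumFields.BalabanUV.Beta.DshAn1 (Dsh)
open Summit.QuantumFields.BalabanUV.Beta.AveragingWardRootedStencils (legSite)
open Summit.QuantumFields.BalabanUV.Beta.CompositeCorrectorLocality (blockSitesF)
open Summit.QuantumFields.BalabanUV.Beta.SymCorrectorKernel (psiKS)
open Summit.QuantumFields.BalabanUV.Beta.SymCorrectorFace (faceWt)
open Summit.QuantumFields.BalabanUV.Beta.SymCorrectorFaceGauge (vertexOfK_conj_psiKS_eq_add_faceGauge)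
open Summit.QuantumFields.BalabanUV.Beta.CombChartStepJets (JsB12CombSh0)
open Summit.QuantumFields.BalabanUV.Beta.SymSecondOrderTablesAn1 (symTablesAn1S2)
open Summit.QuantumFields.BalabanUV.Beta.D1BFx.RawStencilSupportRows (locStencil_JsB12CombSh0_S_zero_of_decays)
open Summit.QuantumFields.BalabanUV.Beta.D1BFx.ColumnGaugeCombPartner (divV_S_zero_eq_smul_conjV_leggedBorder vertexOfK_G0bm_S_zero_eq_add_comm)

noncomputable section

variable {n : ℕ} [NeZero n]

/-- **THE FULLY DRESSED FIRST-ORDER VERTEX OF THE COMB LITERAL = THE STRAIGHT VERTEX + TWO COMMUTATORS WITH THE LEGGED BORDER** [our object]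
(chart transport by `Ψ̂_{r′}` AND bm column dressing at the centred root; literal of record at level 0; partner `bhK n + Dsh n`, scalar `n⁴∕2` inside
both generators). -/
theorem vertexOfK_psiKS_G0bm_S_zero_eq (hodd : Odd n) (N : ℕ) (cΛ cB : ℝ) {r' : Fin 4 → ℕ} (hr' : r' ∈ box 4 n) (μ : Fin 4) (y : Site 4) :
    vertexOfK (comp (comp (psiKS r' n) (coDressKBmAt (ctr 4 n) n (KInvStep (d := 3) n 0))) (trK (psiKS r' n))) n
        (JsB12CombSh0 hodd N (symTablesAn1S2 3 n cΛ) cΛ cB 0).S μ y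
      = vertexOfK (KInvStep (d := 3) n 0) n (JsB12CombSh0 hodd N (symTablesAn1S2 3 n cΛ) cΛ cB 0).S μ y
        + (comp (diagK (fun z b => (n : ℝ) ^ 4 / 2 * bmGaugeAt (ctr 4 n) (colH (KInvStep (d := 3) n 0) n μ y) n (legSite (ctr 4 n) z b)))
              (bhK n + Dsh n)
            - comp (bhK n + Dsh n)
              (diagK (fun z b => (n : ℝ) ^ 4 / 2 * bmGaugeAt (ctr 4 n) (colH (KInvStep (d := 3) n 0) n μ y) n (legSite (ctr 4 n) z b))))
        + (comp (diagK fun z b => -(∑ α : Fin 4, ∑ x ∈ blockSitesF n (blk n (legSite (ctr 4 n) z b)),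
                colH (coDressKBmAt (ctr 4 n) n (KInvStep (d := 3) n 0)) n μ y α x * ((n : ℝ) ^ 4 / 2 * faceWt r' n α x))) (bhK n + Dsh n)
            - comp (bhK n + Dsh n) (diagK fun z b => -(∑ α : Fin 4, ∑ x ∈ blockSitesF n (blk n (legSite (ctr 4 n) z b)),
                colH (coDressKBmAt (ctr 4 n) n (KInvStep (d := 3) n 0)) n μ y α x * ((n : ℝ) ^ 4 / 2 * faceWt r' n α x)))) := by
  have hn1 : 1 ≤ n := Nat.one_le_iff_ne_zero.2 (NeZero.ne n)
  have hn0 : 0 < n := hn1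
  obtain ⟨δK, CK, hδK, hCK, hKd⟩ := OneStepResolventKernel.decays_KInv (N := n) (d := 3)
  obtain ⟨Cs, -, hS⟩ := locStencil_JsB12CombSh0_S_zero_of_decays hodd N (symTablesAn1S2 3 n cΛ) cΛ cB hKd hCK hδK
  have hK0 : Spr (KInvStep (d := 3) n 0) := by
    obtain ⟨δ, C, hδ, -, hdec⟩ := OneStepKernelFamily.decays_KInvStep (Lc := n) (d := 3) 0
    exact ⟨C, δ, hδ, hdec⟩
  have hK : Spr (coDressKBmAt (ctr 4 n) n (KInvStep (d := 3) n 0)) := spr_coDressKBmAt hn1 (ctrOff_mem_box hn1) hK0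
  rw [vertexOfK_conj_psiKS_eq_add_faceGauge hn0 (fun u => divV_S_zero_eq_smul_conjV_leggedBorder hodd N cΛ cB u) hr' hK hS (half_pos hδK) μ y,
    vertexOfK_G0bm_S_zero_eq_add_comm hodd N cΛ cB μ y]

end

end Summit.QuantumFields.BalabanUV.Beta.D1BFx.ColumnGaugeCombMergedFirstOrder
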